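import Mathlib
import Literature.MathematicalPhysics.QuantumFieldTheory.Balaban1983to89.B5Eq118OneStroke
import Literature.MathematicalPhysics.QuantumFieldTheory.Balaban1983to89.B5Prop11G0TowerMass
import Literature.MathematicalPhysics.QuantumFieldTheory.Balaban1983to89.B5Eq121HodgeIdentityVector

/-!
# `Balaban1983to89.B5Prop11FlatSliceCurlCoercivity` — T. Bałaban, *Propagators and renormalization transformations for lattice gauge theories. I*, Commun. Math.
# Phys. **95** (1984) 17–40 [Balaban1984PropagatorsI], Prop. 1.1 (1.90) p. 33 + (1.21) p. 21 + (1.18) p. 20, READ TOGETHER FOR VECTOR-VALUED BOND FIELDS ON THE LANDAU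
# SLICE: «γ₀‖x‖² ≤ η⁻²·Σ_p ‖(∂x)(p)‖²» for every `W`-valued bond field `x` on the fine torus with `∂*x = 0` and `Q_K x = 0` — THE FLAT, GAUGE-FIXED, CONSTRAINED
# HESSIAN OF THE WILSON ACTION IS COERCIVE, with N02's constant `γ₀ = gammaG0 d a` BY NAME (`B5Prop11G0TowerMass.form_M0_zero_ge`).  On the way ((J-iii)′ of the
# N12 lane): THE TREE's TWO TYPINGS OF `Q_k` (1.18) AGREE — V1's `LatticeFieldCalculus.bondAvgIter k` (NODE 00's carriers) and N02's matrix `B5Eq133G0Torus.Qv P k μ`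
# are the same map, componentwise.  PROVED.

Honest framing: statement-level skeleton of published theorems with citation tags; proofs where landed; nothing here is a claim about the
Yang–Mills mass gap.

Cell `pub-ymgap` (HUMAN RULINGS D-0062 ∕ D-0149), WIDTH SEAT `pub-ymgap-dag-n12-w3` g0 (node N12 = [B15]; key K1⁷ `stmt-QuantumFields-20542`, `--kind proof
--supports …`; count-neutral); lane word dag-n12-c g16 (INBOX 2026-08-28 01:42Z: after (J-i)∕(J-ii), «(J-iii)′ the μ-component identification `Q^{(j)}` ↔ `QvOp`»; the §3 assembly is the
(x)-census' «hnd by name from N02» in the one configuration where it is literally available: flat background, Landau slice, level `K`).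

WHY.  The N12 chain meets N02's [B5] Prop. 1.1 (1.90) (`B5Prop11G0TowerMass.prop11_g0Setting_mass`, operator `M0 a m² k μ = lapEta + a·(Qv k μ)ᵀ(Qv k μ)` on
`Site P 0 → ℝ`) only if the averaging constraint of NODE 00's chart — iterates of the linearised average, typed on the V1 side as `bondAvgIter` (`B5Eq120IterProof`,
`B5Eq118OneStroke.bondAvgIter_eq_blockSum`, `B5AverageCurlStokesV1 §6`) — is LITERALLY N02's `Qv`.  Both files typed (1.18); nobody had stated that they agree.

WHAT THIS FILE PROVES (theorems only; no `def`; no `sorry`; axioms standard; standing range `k ≤ m + K`).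
* `iterBlockOf_eq_proj` ∕ `iterBlock_eq_filter_proj` — the `k`-fold block map ∕ block of `B5Eq118OneStroke` IS `B1RG242Torus.Site.proj k k` ∕ its fibre (both have
  labels `⌊n ∕ L^k⌋`: `val_iterBlockOf`, `Site.val_proj`);
* `segSum_eq_sum_shiftN` — the straight-contour sum `A([x, x + n e_μ])` of `LatticeFieldCalculus` is `Σ_{t<n} A⟨shiftN x μ t, μ⟩` of `B5Eq133G0Torus` (`rfl`);
* ★★ `bondAvgIter_apply_eq_Qv_mulVec` — FOR REAL-VALUED FIELDS `(Q_k A)⟨y, μ⟩ = (Qv P k μ *ᵥ A_μ)(y)`, `A_μ := fun x => A⟨x, μ⟩`;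
* `map_bondAvgIter` — `bondAvgIter` commutes with every `ℝ`-linear map of the values (it is a finite average);
* ★★ `inner_bondAvgIter_eq_Qv_mulVec` ∕ `repr_bondAvgIter_eq_Qv_mulVec` — FOR `W`-VALUED FIELDS (any real inner-product space, e.g. `𝔰𝔲(N)`, `ℝ³`), every scalar
  component of `Q_k A` is `Qv` of that component: `⟪w, (Q_kA)⟨y,μ⟩⟫ = (Qv P k μ *ᵥ (x ↦ ⟪w, A⟨x,μ⟩⟫))(y)`, and the same in an orthonormal frame;
* §3 `dotProduct_M0_mulVec_of_Qv_eq_zero` (on `ker Qv` the constraint term of `M0 = Δ + a·QvᵀQv` drops), ★★★ `gammaG0_mul_sum_normSq_le_of_div_eq_zero_of_Qv_eq_zero` ∕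
  ★★★ `gammaG0_mul_sum_normSq_le_curl_of_bondAvgIter_eq_zero` — PROP. 1.1 COERCIVITY OF THE FLAT CONSTRAINED LANDAU-SLICE FORM: for finite-dimensional `W`, `a > 0`,
  `x : PBond P 0 → W` with `∂*x = 0` and `Q_K x = 0` (`bondAvgIter P.K x = 0`),
  `gammaG0 d a · Σ_t Σ_μ ‖x⟨t,μ⟩‖² ≤ (ε ∕ (L^Kε))⁻² · Σ_p ‖x⟨s,μ⟩ + x⟨s+e_μ,ν⟩ − x⟨s+e_ν,μ⟩ − x⟨s,ν⟩‖²`; ★ `sum_plaq_normSq_pos_of_ne_zero` — hence the curl energy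
  (n12-w2's flat second variation summand) is STRICTLY POSITIVE on every non-zero such `x`: the `hnd`-shaped nondegeneracy on that slice.

HONEST SCOPE.  §1–§2 are bookkeeping between two typings of one printed formula; §3 composes CITED tree theorems (N02's `form_M0_zero_ge`, this seat's (1.21) file) — the
only estimate is N02's, consumed by name at ITS level `k = K` and ITS Laplacian scaling `s = ε ∕ spacing K`.  What §3 is NOT: it is the LANDAU slice `∂*x = 0` on the whole
fine torus with the ITERATED STRAIGHT average `Q_K` as constraint — not NODE 00's chart of record (axial gauge inside blocks, the (0.4) average with staircase tails
`linAvg = L•bondAvg − grad`, curved background); carrying it to the record's `hnd` needs the gauge comparison (x)-census items 3–4.  The further identification of NODE 00's linearised averaging OF RECORD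
(`Node00.msChart` ∕ `linAvg` iterates, gauge tails) with `bondAvgIter` modulo coarse gradients is `BlockAveragingEMLLinearised.linAvg_eq_bondAvg_sub_grad_combMean` (one
step) + `B5Eq120IterProof.bondAvgIter_grad` (gradients through the iterate) — cited, not re-proved, not composed here.  Count-neutral; N12 NOT discharged; the YM mass gap
(Clay) is NOT proved by any of this — R4 closes only the conditional finite-𝕋⁴ rung `BalabanLadder.UV`; nothing continuum ∕ OS.  0 kit, 0 lit wants.

## References
* [Balaban1984PropagatorsI] T. Bałaban, Commun. Math. Phys. 95 (1984) 17–40: (1.6) p. 18, (1.8) p. 19, (1.18)–(1.21) pp. 20–21, Prop. 1.1 (1.89)–(1.90) p. 33,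
  (1.132) p. 39 («G₀ = (Δ + aQ*Q)⁻¹»; `spacing K = 1`, so `ε ∕ spacing K = ε = L^{−K} = η`).
-/

noncomputable section

open Finset Matrix
open scoped BigOperators InnerProductSpace

namespace Literature.MathematicalPhysics.QuantumFieldTheory.Balaban1983to89.B5Prop11FlatSliceCurlCoercivity

open LatticeFieldCalculus B5Eq118OneStroke B5Eq133G0Torus B1RG242Torus

variable {P : Params} {k : ℕ} {V : Type*} [AddCommGroup V] [Module ℝ V]

/-! ## §1  The two block maps and the two straight contours agree -/

omit [AddCommGroup V] [Module ℝ V] in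
/-- The `k`-fold block map of `B5Eq118OneStroke` is `Site.proj k k` of `B1RG242Torus` (standing range): both send the label `n` to `⌊n ∕ L^k⌋`
coordinatewise. [cite: Balaban1984PropagatorsI, (1.6) p.18, (1.18) p.20] -/
theorem iterBlockOf_eq_proj (hk : k ≤ P.m + P.K) (x : Site P 0) : iterBlockOf k x = Site.proj k k x := by
  have h0 : P.sitesPerDir 0 = P.L ^ k * P.sitesPerDir k := by
    have := sitesPerDir_zero_eq P k; rwa [lvl_of_le P hk] at this
  funext μ
  apply ZMod.val_injective
  rw [val_iterBlockOf k hk x μ, Site.val_proj h0 x μ]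

omit [AddCommGroup V] [Module ℝ V] in
/-- The block of order `k` of `B5Eq118OneStroke` is the fibre of `Site.proj k k` (the summation range of `B1RG242Torus.Qk_mulVec` ∕ `B5Eq133G0Torus.Qv_mulVec`).
[cite: Balaban1984PropagatorsI, (1.18) p.20] -/
theorem iterBlock_eq_filter_proj (hk : k ≤ P.m + P.K) (y : Site P k) :
    iterBlock k y = Finset.univ.filter (fun x : Site P 0 => Site.proj k k x = y) := by
  ext x
  rw [mem_iterBlock, Finset.mem_filter, iterBlockOf_eq_proj hk]
  simp

omit [Module ℝ V] in
/-- The straight-contour sum of `LatticeFieldCalculus` along `[x, x + n e_μ]` is the sum over the shifted sites `shiftN x μ t`, `t < n`, of `B5Eq133G0Torus`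
(the two files typed the same sites `x + t e_μ` under two names). [cite: Balaban1984PropagatorsI, (1.8) p.19, (1.18) p.20] -/
theorem segSum_eq_sum_shiftN (A : VecField P 0 V) (x : Site P 0) (μ : Fin P.d) (n : ℕ) :
    segSum A x μ n = ∑ t ∈ Finset.range n, A ⟨shiftN P x μ t, μ⟩ := rfl

/-- The two normalisations agree: `(L^{d+1})^{−k} = (L^{−k})^{d+1} = η^{d+1}`. [folklore] -/
private theorem norm_const_eq (k : ℕ) : (((P.L : ℝ) ^ (P.d + 1)) ^ k)⁻¹ = (((P.L : ℝ) ^ k)⁻¹) ^ (P.d + 1) := by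
  rw [inv_pow, ← pow_mul, ← pow_mul, mul_comm]

/-! ## §2  `bondAvgIter = Qv`, componentwise -/

/-- ★★ **THE V1 ITERATED BOND AVERAGE IS N02's `Qv` (real-valued fields)**: for `A : VecField P 0 ℝ` and `k ≤ m + K`,
`(Q_k A)⟨y, μ⟩ = (Qv P k μ *ᵥ (x ↦ A⟨x, μ⟩))(y) = η^{d+1} Σ_{x∈B^k(y)} Σ_{t<L^k} A⟨x + t e_μ, μ⟩`. [cite: Balaban1984PropagatorsI, (1.18) p.20] -/
theorem bondAvgIter_apply_eq_Qv_mulVec (hk : k ≤ P.m + P.K) (A : VecField P 0 ℝ) (y : Site P k) (μ : Fin P.d) :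
    bondAvgIter k A ⟨y, μ⟩ = (Qv P k μ *ᵥ fun x : Site P 0 => A ⟨x, μ⟩) y := by
  rw [bondAvgIter_eq_blockSum k hk A ⟨y, μ⟩, Qv_mulVec hk, iterBlock_eq_filter_proj hk, norm_const_eq, smul_eq_mul]
  rfl

/-- **`bondAvgIter` COMMUTES WITH LINEAR MAPS OF THE VALUES** (it is a finite linear combination of the values of `A`). [cite: Balaban1984PropagatorsI, (1.18) p.20] -/
theorem map_bondAvgIter {V' : Type*} [AddCommGroup V'] [Module ℝ V'] (φ : V →ₗ[ℝ] V') (hk : k ≤ P.m + P.K) (A : VecField P 0 V) (b : PBond P k) :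
    φ (bondAvgIter k A b) = bondAvgIter k (fun b' => φ (A b')) b := by
  rw [bondAvgIter_eq_blockSum k hk A b, bondAvgIter_eq_blockSum k hk _ b, map_smul, map_sum]
  congr 1
  refine Finset.sum_congr rfl fun x _ => ?_
  simp only [segSum, map_sum]

variable {W : Type*} [NormedAddCommGroup W] [InnerProductSpace ℝ W]

/-- ★★ **FOR `W`-VALUED FIELDS EVERY SCALAR COMPONENT OF `Q_k A` IS `Qv` OF THAT COMPONENT**: `⟪w, (Q_kA)⟨y,μ⟩⟫ = (Qv P k μ *ᵥ (x ↦ ⟪w, A⟨x,μ⟩⟫))(y)` for every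
`w ∈ W` (`W` any real inner-product space — `𝔰𝔲(N)` with the Frobenius form, n12-c's `ℝ³`). [cite: Balaban1984PropagatorsI, (1.18) p.20] -/
theorem inner_bondAvgIter_eq_Qv_mulVec (hk : k ≤ P.m + P.K) (A : VecField P 0 W) (w : W) (y : Site P k) (μ : Fin P.d) :
    ⟪w, bondAvgIter k A ⟨y, μ⟩⟫_ℝ = (Qv P k μ *ᵥ fun x : Site P 0 => ⟪w, A ⟨x, μ⟩⟫_ℝ) y := by
  have h := map_bondAvgIter (innerₛₗ ℝ w) hk A ⟨y, μ⟩
  simp only [innerₛₗ_apply_apply] at h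
  rw [h, bondAvgIter_apply_eq_Qv_mulVec hk]

/-- ★★ **IN AN ORTHONORMAL FRAME**: the `a`-th coordinate of `(Q_kA)⟨y,μ⟩` is `Qv` of the `a`-th coordinate field — the form in which the sum over components of
`B5Eq121HodgeIdentityVector.sum_dotProduct_hOp_components_eq` meets `prop11_g0Setting_mass` component by component. [cite: Balaban1984PropagatorsI, (1.18) p.20] -/
theorem repr_bondAvgIter_eq_Qv_mulVec {ι : Type*} [Fintype ι] (b : OrthonormalBasis ι ℝ W) (hk : k ≤ P.m + P.K) (A : VecField P 0 W) (a : ι)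
    (y : Site P k) (μ : Fin P.d) :
    b.repr (bondAvgIter k A ⟨y, μ⟩) a = (Qv P k μ *ᵥ fun x : Site P 0 => b.repr (A ⟨x, μ⟩) a) y := by
  simp only [OrthonormalBasis.repr_apply_apply]
  exact inner_bondAvgIter_eq_Qv_mulVec hk A (b a) y μ

/-! ## §3  Prop. 1.1 coercivity of the flat, constrained, Landau-slice form for `W`-valued bond fields -/

omit [InnerProductSpace ℝ W] in
/-- On `ker Qv` the constraint term of `M0 = (−Δ^s + s_k²m²) + a·QvᵀQv` drops: `f ⬝ᵥ (M0 f) = f ⬝ᵥ ((−Δ^s + s_k²m²) f)` when `Qv f = 0`.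
[cite: Balaban1984PropagatorsI, (1.132) p.39] -/
theorem dotProduct_M0_mulVec_of_Qv_eq_zero (a msq : ℝ) (k : ℕ) (μ : Fin P.d) (f : Site P 0 → ℝ) (hf : Qv P k μ *ᵥ f = 0) :
    f ⬝ᵥ (M0 P a msq k μ *ᵥ f) = f ⬝ᵥ (hOp P 0 (P.eps / P.spacing k) (P.spacing k ^ 2 * msq) *ᵥ f) := by
  rw [M0, Matrix.add_mulVec, Matrix.smul_mulVec, ← Matrix.mulVec_mulVec, hf, Matrix.mulVec_zero, smul_zero, add_zero]

/-- Parseval summed over sites and directions: `Σ_a Σ_μ f_{aμ} ⬝ᵥ f_{aμ} = Σ_t Σ_μ ‖x⟨t,μ⟩‖²`. [folklore] -/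
private theorem sum_dotProduct_self_components_eq {ι : Type*} [Fintype ι] (b : OrthonormalBasis ι ℝ W) (x : PBond P k → W) :
    ∑ a, ∑ μ : Fin P.d, (fun t : Site P k => ⟪b a, x ⟨t, μ⟩⟫_ℝ) ⬝ᵥ (fun t : Site P k => ⟪b a, x ⟨t, μ⟩⟫_ℝ)
      = ∑ t : Site P k, ∑ μ : Fin P.d, ‖x ⟨t, μ⟩‖ ^ 2 := by
  have hP : ∀ v : W, ‖v‖ ^ 2 = ∑ a, ⟪b a, v⟫_ℝ ^ 2 := fun v => by
    rw [← real_inner_self_eq_norm_sq, ← b.sum_inner_mul_inner v v]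
    exact Finset.sum_congr rfl fun a _ => by rw [real_inner_comm (b a) v, sq]
  simp only [dotProduct, ← sq]
  rw [Finset.sum_comm]
  refine (Finset.sum_congr rfl fun μ _ => Finset.sum_comm).trans ?_
  rw [Finset.sum_comm]
  exact Finset.sum_congr rfl fun t _ => Finset.sum_congr rfl fun μ _ => (hP _).symm

/-- ★★★ **PROP. 1.1 COERCIVITY OF THE FLAT CONSTRAINED LANDAU-SLICE FORM** (N02's (1.90) for `G₀`, by name, summed over the scalar components): for `a > 0`, a
finite-dimensional real inner-product space `W` with orthonormal frame `b`, and a bond field `x` on the fine torus `T^{(0)}` with `∂*x = 0` whose every scalar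
component is in `ker Q_K` (`Qv P K μ *ᵥ (t ↦ ⟪b_a, x⟨t,μ⟩⟫) = 0`),
`γ₀ · Σ_t Σ_μ ‖x⟨t,μ⟩‖² ≤ (ε∕(L^Kε))⁻² · Σ_p ‖x⟨s,μ⟩ + x⟨s+e_μ,ν⟩ − x⟨s+e_ν,μ⟩ − x⟨s,ν⟩‖²`, `γ₀ = gammaG0 d a`.
[cite: Balaban1984PropagatorsI, Prop. 1.1 (1.90) p.33, (1.21) p.21, (1.132) p.39] -/
theorem gammaG0_mul_sum_normSq_le_of_div_eq_zero_of_Qv_eq_zero {ι : Type*} [Fintype ι] (b : OrthonormalBasis ι ℝ W) {a : ℝ} (ha : 0 < a)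
    (x : PBond P 0 → W) (hdiv : ∀ t : Site P 0, ∑ μ : Fin P.d, (x ⟨t.unshift μ, μ⟩ - x ⟨t, μ⟩) = 0)
    (havg : ∀ (c : ι) (μ : Fin P.d), Qv P P.K μ *ᵥ (fun t : Site P 0 => ⟪b c, x ⟨t, μ⟩⟫_ℝ) = 0) :
    B5Prop11G0Torus.gammaG0 P.d a * ∑ t : Site P 0, ∑ μ : Fin P.d, ‖x ⟨t, μ⟩‖ ^ 2
      ≤ ((P.eps / P.spacing P.K)⁻¹) ^ 2
          * ∑ p : Plaq P 0, ‖x ⟨p.src, p.μ⟩ + x ⟨p.src.shift p.μ, p.ν⟩ - x ⟨p.src.shift p.ν, p.μ⟩ - x ⟨p.src, p.ν⟩‖ ^ 2 := by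
  -- N02's (1.90) for `G₀`, component by component, in the direction-`μ` setting of that component
  have h190 : ∀ (c : ι) (μ : Fin P.d),
      B5Prop11G0Torus.gammaG0 P.d a * ((fun t : Site P 0 => ⟪b c, x ⟨t, μ⟩⟫_ℝ) ⬝ᵥ (fun t : Site P 0 => ⟪b c, x ⟨t, μ⟩⟫_ℝ))
        ≤ (fun t : Site P 0 => ⟪b c, x ⟨t, μ⟩⟫_ℝ) ⬝ᵥ (hOp P 0 (P.eps / P.spacing P.K) (P.spacing P.K ^ 2 * 0) *ᵥ fun t : Site P 0 => ⟪b c, x ⟨t, μ⟩⟫_ℝ) := by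
    intro c μ
    rw [← dotProduct_M0_mulVec_of_Qv_eq_zero a 0 P.K μ _ (havg c μ)]
    exact (B5Prop11G0TowerMass.form_M0_zero_ge P ha μ _).1
  have hsum := Finset.sum_le_sum fun c (_ : c ∈ (Finset.univ : Finset ι)) => Finset.sum_le_sum fun μ (_ : μ ∈ (Finset.univ : Finset (Fin P.d))) => h190 c μ
  simp only [← Finset.mul_sum] at hsum
  rw [sum_dotProduct_self_components_eq b x, mul_zero,
    B5Eq121HodgeIdentityVector.sum_dotProduct_hOp_components_eq_curl_of_div_eq_zero b _ x hdiv] at hsum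
  exact hsum

/-- ★★★ **THE SAME WITH THE V1 CONSTRAINT `Q_K x = 0`** (`LatticeFieldCalculus.bondAvgIter`, NODE 00's carriers — by §2 every scalar component is then in `ker Qv`).
[cite: Balaban1984PropagatorsI, Prop. 1.1 (1.90) p.33, (1.18) p.20, (1.21) p.21] -/
theorem gammaG0_mul_sum_normSq_le_curl_of_bondAvgIter_eq_zero [FiniteDimensional ℝ W] {a : ℝ} (ha : 0 < a)
    (x : PBond P 0 → W) (hdiv : ∀ t : Site P 0, ∑ μ : Fin P.d, (x ⟨t.unshift μ, μ⟩ - x ⟨t, μ⟩) = 0) (havg : bondAvgIter P.K x = 0) :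
    B5Prop11G0Torus.gammaG0 P.d a * ∑ t : Site P 0, ∑ μ : Fin P.d, ‖x ⟨t, μ⟩‖ ^ 2
      ≤ ((P.eps / P.spacing P.K)⁻¹) ^ 2
          * ∑ p : Plaq P 0, ‖x ⟨p.src, p.μ⟩ + x ⟨p.src.shift p.μ, p.ν⟩ - x ⟨p.src.shift p.ν, p.μ⟩ - x ⟨p.src, p.ν⟩‖ ^ 2 := by
  have b := stdOrthonormalBasis ℝ W
  refine gammaG0_mul_sum_normSq_le_of_div_eq_zero_of_Qv_eq_zero b ha x hdiv fun c μ => ?_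
  funext y
  rw [← inner_bondAvgIter_eq_Qv_mulVec (Nat.le_add_left _ _) x (b c) y μ, havg]
  simp

/-- ★ **NONDEGENERACY ON THE SLICE (`hnd`-shaped)**: a non-zero `W`-valued bond field on the fine torus with `∂*x = 0` and `Q_K x = 0` has STRICTLY POSITIVE curl energy
`Σ_p ‖x⟨s,μ⟩ + x⟨s+e_μ,ν⟩ − x⟨s+e_ν,μ⟩ − x⟨s,ν⟩‖² > 0` (for any `a > 0` in N02's constant; `W` finite-dimensional).
[cite: Balaban1984PropagatorsI, Prop. 1.1 (1.90) p.33, (1.21) p.21] -/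
theorem sum_plaq_normSq_pos_of_ne_zero [FiniteDimensional ℝ W] (x : PBond P 0 → W) (hx : x ≠ 0)
    (hdiv : ∀ t : Site P 0, ∑ μ : Fin P.d, (x ⟨t.unshift μ, μ⟩ - x ⟨t, μ⟩) = 0) (havg : bondAvgIter P.K x = 0) :
    0 < ∑ p : Plaq P 0, ‖x ⟨p.src, p.μ⟩ + x ⟨p.src.shift p.μ, p.ν⟩ - x ⟨p.src.shift p.ν, p.μ⟩ - x ⟨p.src, p.ν⟩‖ ^ 2 := by
  have h := gammaG0_mul_sum_normSq_le_curl_of_bondAvgIter_eq_zero (a := 1) one_pos x hdiv havg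
  have hγ : 0 < B5Prop11G0Torus.gammaG0 P.d (1 : ℝ) := B5G0BridgeP12.gammaG0_pos' zero_le_one
  -- `x ≠ 0` gives a bond with `‖x b‖² > 0`
  have hpos : 0 < ∑ t : Site P 0, ∑ μ : Fin P.d, ‖x ⟨t, μ⟩‖ ^ 2 := by
    obtain ⟨b₀, hb₀⟩ : ∃ b₀ : PBond P 0, x b₀ ≠ 0 := by
      by_contra hno
      push Not at hno
      exact hx (funext hno)
    have hle : ‖x b₀‖ ^ 2 ≤ ∑ t : Site P 0, ∑ μ : Fin P.d, ‖x ⟨t, μ⟩‖ ^ 2 := by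
      have h1 : ‖x ⟨b₀.src, b₀.dir⟩‖ ^ 2 ≤ ∑ μ : Fin P.d, ‖x ⟨b₀.src, μ⟩‖ ^ 2 :=
        Finset.single_le_sum (f := fun μ => ‖x ⟨b₀.src, μ⟩‖ ^ 2) (fun μ _ => by positivity) (Finset.mem_univ b₀.dir)
      exact h1.trans (Finset.single_le_sum (f := fun t => ∑ μ : Fin P.d, ‖x ⟨t, μ⟩‖ ^ 2)
        (fun t _ => Finset.sum_nonneg fun μ _ => by positivity) (Finset.mem_univ b₀.src))
    have hb : 0 < ‖x b₀‖ ^ 2 := by positivity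
    linarith
  have hlhs : 0 < B5Prop11G0Torus.gammaG0 P.d (1 : ℝ) * ∑ t : Site P 0, ∑ μ : Fin P.d, ‖x ⟨t, μ⟩‖ ^ 2 := mul_pos hγ hpos
  have hc : 0 ≤ ((P.eps / P.spacing P.K)⁻¹) ^ 2 := sq_nonneg _
  by_contra hneg
  have h0 : ∑ p : Plaq P 0, ‖x ⟨p.src, p.μ⟩ + x ⟨p.src.shift p.μ, p.ν⟩ - x ⟨p.src.shift p.ν, p.μ⟩ - x ⟨p.src, p.ν⟩‖ ^ 2 = 0 :=
    le_antisymm (not_lt.1 hneg) (Finset.sum_nonneg fun p _ => by positivity)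
  rw [h0, mul_zero] at h
  exact absurd h (not_le.2 hlhs)

end Literature.MathematicalPhysics.QuantumFieldTheory.Balaban1983to89.B5Prop11FlatSliceCurlCoercivity

end
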